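import Summits.NavierStokesRegularity.NavierStokesRegularity.Theorems.StrainDoorsMorreyBoundFromSupTypeI
import Summits.NavierStokesRegularity.NavierStokesRegularity.Theorems.StrainDoorsMorreyTypeIFixedDelta
import HarnessLib

/-!
# Strain doors, PART M §M28(g)–(i) — Barker–Prange's Theorem 3 with a fixed `δ₀` along a sequence of times,
# UNCONDITIONAL in the energy class for sup-norm Type-I solutions; every-slice `L³` concentration; door X″

ROUND 69 of the `ns-regularity-ideate` programme (p1 line; helper lane of `stmt-NavierStokesRegularity-0056`,
rung N0; nothing here is a claim about Navier–Stokes regularity).  ROUND 68 proved Barker–Prange's Theorem 3 with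
one fixed `δ₀` on one sequence of slices for solutions which are Type I both in the sup-norm (`|u| ≤ M/√(T − t)`)
and in the `L²`-Morrey sense (`‖u(t)‖_{L²(B_r(y))} ≤ M₂√r`, `T − r² < t < T`), and typed the door X′: «the
sup-norm rate plus the energy class give the Morrey bound with `M₂ = M₂(M, ‖u₀‖₂, T)`».  ROUND 69 PROVES X′ in
three texts: `StrainDoorsSupTypeIScaledEnergies` (§M28(a)–(d): the rate interpolation and the base-scale data),
`StrainDoorsMorreyBoundFromSupTypeI` (§M28(e)–(f): Seregin's iteration with data-uniform constants and the Morrey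
bound), `StrainDoorsFixedDeltaSupTypeI` (§M28(g)–(i): the fixed-`δ₀` criterion and the every-slice concentration
made unconditional in the energy class; door X″ typed).

THIS FILE (imports §M28(e)–(f) `StrainDoorsMorreyBoundFromSupTypeI` and ROUND 68's text N9
`StrainDoorsMorreyTypeIFixedDelta`):
* §M28(g) ★★★★ `sliceAligned_fixedDelta_not_singular_of_supTypeI` — §M27(c) with the Morrey hypothesis
  discharged by §M28(f): `δ₀ = δ₀(M, E₀, T₀, R)`;
* §M28(h) ★★★ `sliceL3Concentration_energyClass` — the conclusion of door X (§M26) on EVERY slice `t ∈ (0,T)` at a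
  singular point of a sup-norm Type-I classical Leray–Hopf solution, with an absolute `γ` and `R_m = R_m(M, E₀, T₀)`
  (§M27(b) at `ν = 1` ∘ §M28(f));
* §M28(i) door X″ `UlocMorreyBoundSupTypeI` (typed, OPEN): the Morrey bound with a constant depending on `M`
  ALONE at radii `r² < T` (scale invariant; the uniformly-local energy Gronwall under the rate) — what still
  separates (g)/(h) from door X.
No `sorry`, no new axioms, no instances, no notation; one parameterless `def … : Prop` (door X″) WITHOUT cite tag.
-/

noncomputable section

set_option linter.dupNamespace false

open MeasureTheory Set Function Filter Metric Real
open _root_.Topology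
open scoped ENNReal NNReal
open Literature.Analysis Literature.Analysis.FluidPDE
open Literature.Analysis.FluidPDE.LocalTypeIBlowup

namespace Summit.NavierStokesRegularity.NavierStokesRegularity.Theorems.StrainDoors

/-! ### §M28(g) ★★★★ Barker–Prange Theorem 3 with a fixed `δ₀` along a sequence of times — UNCONDITIONAL in
the energy class under the sup-norm Type-I rate -/

/-- ★★★★ **BARKER–PRANGE THEOREM 3 WITH A FIXED `δ₀` ALONG A SEQUENCE OF TIMES, FOR SOLUTIONS WHICH ARE
TYPE I IN THE SUP-NORM — THE MORREY HYPOTHESIS OF §M27(c) DISCHARGED.**  For `M, E₀`, `T₀ > 0` and `R > 0`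
there is `δ₀ = δ₀(M, E₀, T₀, R) > 0` such that: if `(u,p)` is a classical solution of the unit-viscosity unforced
Navier–Stokes system on `ℝ³ × [0,T)`, `T ≥ T₀`, Leray–Hopf on `[0,T)`, with `∫|u₀|² ≤ E₀` and
`|u(t,x)| ≤ M/√(T − t)` on `(0,T)`, and if along SOME sequence of times `s_n → T` in `(0,T)` the vorticity
directions satisfy `|ξ(x,s_n) − ξ(y,s_n)| ≤ δ₀` for all `x, y ∈ B(x₀, R√(T − s_n))` with `|ω(·,s_n)| > d` at
both, then `(T,x₀)` is NOT a singular point.  (= §M27(c) ∘ §M28(f).)  Barker–Prange's Theorem 3 asks the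
direction modulus `|ξ(x,t) − ξ(y,t)| ≤ η(|x − y|)`, `η(r) → 0`, at ALL times near `T`; here one fixed `δ₀` on
one sequence of slices suffices, the price being the dependence of `δ₀` on `(M, ‖u₀‖₂, T₀, R)`.
[cite: BarkerPrange2020Alignment, Thm 3 (arXiv:1906.08225 p. 18); BarkerPrange2020, Thm 2 and p. 5
(arXiv:1812.09115 pp. 4–5); AlbrittonBarker2019, Lemmas 2.5–2.6; GigaMiura2011, Thm 1.1] -/
theorem sliceAligned_fixedDelta_not_singular_of_supTypeI (M E₀ T₀ : ℝ) (hT₀ : 0 < T₀) {R : ℝ}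
    (hR : 0 < R) :
    ∃ δ₀ : ℝ, 0 < δ₀ ∧
      ∀ (T : ℝ) (u : ℝ → EuclideanSpace ℝ (Fin 3) → EuclideanSpace ℝ (Fin 3))
        (p : ℝ → EuclideanSpace ℝ (Fin 3) → ℝ), T₀ ≤ T →
        IsClassicalNSSolutionOn (Ico 0 T) 1 0 u p → IsLerayHopfOn T 1 0 (u 0) u →
        ∫ x, ‖u 0 x‖ ^ 2 ≤ E₀ →
        (∀ t ∈ Ioo 0 T, ∀ x : EuclideanSpace ℝ (Fin 3), ‖u t x‖ ≤ M / Real.sqrt (T - t)) →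
        ∀ (x₀ : EuclideanSpace ℝ (Fin 3)) (d : ℝ) (s : ℕ → ℝ), (∀ n, s n ∈ Ioo 0 T) →
          Tendsto s atTop (𝓝 T) →
          (∀ (n : ℕ) (x y : EuclideanSpace ℝ (Fin 3)), x ∈ ball x₀ (R * Real.sqrt (T - s n)) →
            y ∈ ball x₀ (R * Real.sqrt (T - s n)) → d < ‖curl (u (s n)) x‖ → d < ‖curl (u (s n)) y‖ →
              ‖vorticityDirection (curl (u (s n))) x - vorticityDirection (curl (u (s n))) y‖ ≤ δ₀) →
          ¬ IsBackwardSingularPoint u (T, x₀) := by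
  obtain ⟨M₂, hM₂, hMor⟩ := morreyBound_of_supTypeI M E₀ T₀ hT₀
  obtain ⟨δ₀, hδ₀, h⟩ := sliceAligned_fixedDelta_not_singular_of_morreyTypeI M hM₂ hR
  refine ⟨δ₀, hδ₀, ?_⟩
  intro T u p hT hcl hLH hE hI x₀ d s hs hsT hcoh
  exact h T u p (hT₀.trans_le hT) hcl hLH hI (hMor T u p hT hcl hLH hE hI) x₀ d s hs hsT hcoh

/-! ### §M28(h) Door X in the energy class: `L³` concentration on every slice at sup-Type-I singular points -/

/-- ★★★ **EVERY-SLICE `L³` CONCENTRATION AT A SINGULAR POINT OF A SUP-NORM TYPE-I SOLUTION, WITH CONSTANTS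
DEPENDING ON `(M, ‖u₀‖₂, T₀)`** — the conclusion of door X (`SliceL3Concentration`, §M26, whose constants are to
depend on `M` alone) in the energy class: for `M, E₀`, `T₀ > 0` there are an absolute `γ > 0` and
`R_m = R_m(M, E₀, T₀)` such that at every singular point `(T,x₀)` of a classical Leray–Hopf solution on `[0,T)`,
`T ≥ T₀`, with `∫|u₀|² ≤ E₀` and `|u| ≤ M/√(T − t)`: `∫_{B̄(x₀, R_m√(T − t))} |u(t)|³ ≥ γ` for EVERY `t ∈ (0,T)`.
(= §M27(b) at `ν = 1` ∘ §M28(f).)  Door X itself (constants depending on `M` only) stays OPEN; see door X″.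
[cite: BarkerPrange2020, Thm 2 and p. 5 (arXiv:1812.09115 pp. 2, 4–5); AlbrittonBarker2019,
Lemmas 2.5–2.6; Seregin2007, Thm 1.3] -/
theorem sliceL3Concentration_energyClass (M E₀ T₀ : ℝ) (hT₀ : 0 < T₀) :
    ∃ γ Rm : ℝ, 0 < γ ∧ 0 < Rm ∧
      ∀ (T : ℝ) (u : ℝ → EuclideanSpace ℝ (Fin 3) → EuclideanSpace ℝ (Fin 3))
        (p : ℝ → EuclideanSpace ℝ (Fin 3) → ℝ), T₀ ≤ T →
        IsClassicalNSSolutionOn (Ico 0 T) 1 0 u p → IsLerayHopfOn T 1 0 (u 0) u →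
        ∫ x, ‖u 0 x‖ ^ 2 ≤ E₀ →
        (∀ t ∈ Ioo 0 T, ∀ x : EuclideanSpace ℝ (Fin 3), ‖u t x‖ ≤ M / Real.sqrt (T - t)) →
        ∀ x₀ : EuclideanSpace ℝ (Fin 3), IsBackwardSingularPoint u (T, x₀) →
          ∀ t ∈ Ioo 0 T, γ ≤ ∫ x in closedBall x₀ (Rm * Real.sqrt (T - t)), ‖u t x‖ ^ 3 := by
  obtain ⟨M₂, hM₂, hMor⟩ := morreyBound_of_supTypeI M E₀ T₀ hT₀
  obtain ⟨γ, hγ, hL⟩ := l3_concentration_of_morreyTypeI_local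
  obtain ⟨S, hS, hS4, hconc⟩ := hL M₂ hM₂
  refine ⟨γ ^ 3, 2 / Real.sqrt S, pow_pos hγ 3, by positivity, ?_⟩
  intro T u p hT hcl hLH hE hI x₀ hsing t ht
  have hTpos : 0 < T := hT₀.trans_le hT
  have hReg : ∀ t ∈ Ioo 0 T, ∀ x : EuclideanSpace ℝ (Fin 3), IsRegularPoint u (t, x) :=
    fun t ht x => isRegularPoint_of_classical hcl ht x
  have hTypeI : ∀ (y : EuclideanSpace ℝ (Fin 3)) (r : ℝ), 0 < r → ∀ t : ℝ, 0 < t → T - r ^ 2 / 1 < t →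
      t < T → eLpNorm (u t) 2 (volume.restrict (ball y r)) ≤ ENNReal.ofReal (M₂ * 1 * Real.sqrt r) := by
    intro y r hr t' ht0 hwin htT
    rw [mul_one]
    exact hMor T u p hT hcl hLH hE hI y r hr t' ht0 (by rwa [div_one] at hwin) htT
  have hSing : ∀ r : ℝ, 0 < r → r ^ 2 < T →
      eLpNorm (uncurry u) ⊤ (volume.restrict (parabolicCylinder r ((T : ℝ), x₀))) = ⊤ :=
    fun r hr _ => hsing r hr
  have hc := hconc 1 T one_pos hTpos (u 0) u hLH hTypeI hReg x₀ hSing t ht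
  rw [mul_one, one_mul] at hc
  have hrad : 2 * Real.sqrt ((T - t) / S) = 2 / Real.sqrt S * Real.sqrt (T - t) := by
    rw [Real.sqrt_div (by linarith [ht.2] : 0 ≤ T - t)]
    ring
  rw [hrad] at hc
  have hslice : Continuous (u t) := by
    have hc' : ContinuousOn (uncurry u) (Ico 0 T ×ˢ univ) := hcl.smooth_velocity.continuousOn
    exact hc'.comp_continuous (continuous_const.prodMk continuous_id)
      (fun x : EuclideanSpace ℝ (Fin 3) => (⟨⟨ht.1.le, ht.2⟩, mem_univ x⟩ : (t, x) ∈ Ico 0 T ×ˢ univ))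
  exact (pow_three_lt_integral_of_ofReal_lt_eLpNorm hslice hγ.le x₀ _ hc).le

/-! ### §M28(i) Door X″ (typed, OPEN): the Morrey bound with a constant depending on `M` ALONE -/

/-- **DOOR X″ — THE UNIFORMLY-LOCAL `L²`-MORREY BOUND UNDER THE SUP-NORM TYPE-I RATE, WITH A CONSTANT
DEPENDING ON `M` ALONE** (typed, OPEN; the scale-invariant sharpening of §M28(f), and what separates §M28(g)/(h)
from door X of §M26).  For every `M` there is `K = K(M)` such that every classical solution of the unit-viscosity
unforced Navier–Stokes system on `ℝ³ × [0,T)`, Leray–Hopf on `[0,T)`, with `|u(t,x)| ≤ M/√(T − t)` on `(0,T)`,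
satisfies `∫_{B_r(y)} |u(t)|² ≤ K r` for all `y`, all `0 < r` with `r² < T`, and all `T − r² < t < T`.
WHY PLAUSIBLE: in the uniformly-local energy inequality for `α_r(t) = sup_y ∫ φ_{y,r}|u(t)|²` the cubic flux and
both pressure terms (Kang–Miura–Tsai's local/far split) are LINEAR in `α_r` with the integrable weight
`M/(r√(T − s))` once `|u| ≤ M/√(T − s)` is used on one factor, and the start value is
`α_r(T − r²) ≤ (4π/3) M² r` from the rate alone; Gronwall then gives `K(M) = C M² e^{C(1+M)}`.  WHY IT MIGHT
FAIL AS TYPED: only through the bookkeeping of the far-field pressure at radii `r ∼ √T` (the window then starts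
at `t ∼ 0`, where the energy class and not the rate controls `u`); in print the constant is allowed to depend on
the solution (Barker–Prange 2020 p. 5, via Seregin–Zajączkowski 2006 / Seregin 2007).  STATUS: OPEN (ROUND 69);
§M28(f) is its energy-class version with `K = M₂(M, ‖u₀‖₂, T₀)²`. -/
def UlocMorreyBoundSupTypeI : Prop :=
  ∀ M : ℝ, ∃ K : ℝ,
    ∀ (T : ℝ) (u : ℝ → EuclideanSpace ℝ (Fin 3) → EuclideanSpace ℝ (Fin 3))
      (p : ℝ → EuclideanSpace ℝ (Fin 3) → ℝ), 0 < T →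
      IsClassicalNSSolutionOn (Ico 0 T) 1 0 u p → IsLerayHopfOn T 1 0 (u 0) u →
      (∀ t ∈ Ioo 0 T, ∀ x : EuclideanSpace ℝ (Fin 3), ‖u t x‖ ≤ M / Real.sqrt (T - t)) →
      ∀ (y : EuclideanSpace ℝ (Fin 3)) (r : ℝ), 0 < r → r ^ 2 < T → ∀ t : ℝ, T - r ^ 2 < t → t < T →
        ∫ x in ball y r, ‖u t x‖ ^ 2 ≤ K * r

end Summit.NavierStokesRegularity.NavierStokesRegularity.Theorems.StrainDoors

end
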